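/-
Copyright (c) 2026. All rights reserved.
Released under Apache 2.0 license as described in the file LICENSE.
Authors: abc-iut cell, statement-typer seat abc-iut-L4-t3 (wave 1).
-/
import Mathlib.Analysis.SpecialFunctions.Complex.Arg
import Mathlib.Analysis.SpecialFunctions.Complex.Log
import Mathlib.MeasureTheory.Integral.IntervalIntegral.Periodic
import Mathlib.MeasureTheory.Measure.Lebesgue.EqHaar
import HarnessLib

/-!
# [AbsTopIII] Proposition 5.7 (ii): radial and angular volumes on a complex archimedean field

S. Mochizuki, *Topics in absolute anabelian geometry III: global reconstruction algorithms*,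
J. Math. Sci. Univ. Tokyo 22 (2015) 939–1156 [MochizukiAbsTopIII2015]; locators are pages of the
author's manuscript (lit key `paper:url-5493eb38cbb7`), read on the page: statement p. 138 l. 18 –
p. 138 last line, proof p. 139 ll. 9–10 ("well-known properties of the geometry of the complex plane").

Part (ii) of Proposition 5.7 ("elementary and well-known", p. 137): `k` is a complex archimedean field,
`k^× ≅ 𝒪_k^× × ℝ_{>0}` with `𝒪_k^× ≅ S¹`, `pr_ℝ : k → ℝ` the continuous extension of `k^× → ℝ_{>0}`;
`M(k)` (resp. `M̆(k)`) is the set of nonempty compact `A ⊆ k` (resp. `A ⊆ k^×`) whose projection to `ℝ`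
(resp. to `𝒪_k^×`) is the closure of its interior. Then (a) integrating the metric induced by the
standard absolute value over these projections gives the *radial volume* `μ_k : M(k) → ℝ_{>0}` and the
*angular volume* `μ̆_k : M̆(k) → ℝ_{>0}`, additive for projections that are disjoint and normalised by
`μ_k(𝒪_k) = 1`, `μ̆_k(𝒪_k^×) = 2π`; `μ_k^log`, `μ̆_k^log` are their logarithms; (b) `μ̇_k(x) := μ_k(x·𝒪_k)`,
`μ_k^log(x·A) = μ_k^log(A) + μ̇_k^log(x)`, `μ̆_k^log(x·A) = μ̆_k^log(A)`, and `μ_k^log(x·A) = μ_k^log(A)`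
for `x ∈ 𝒪_k^×`; (c) if `exp_k(A) ⊆ 𝒪_k^×` and `pr_ℝ`, `exp_k` are injective on `A ∈ M(k)` then
`μ_k^log(A) = μ̆_k^log(exp_k(A))`.

## What is here (real definitions; `k` modelled by `ℂ`)

A complex archimedean field is isomorphic to `ℂ` as a topological field (in two ways, conjugate to
each other, both preserving `|·|`, `𝒪_k`, `𝒪_k^×`); all notions of Prop. 5.7 (ii) are invariant under
complex conjugation, so we state them for `ℂ` (modelling note for the referee). `pr_ℝ = ‖·‖`,
projection to `𝒪_k^× = S¹` = the argument, valued in `AddCircle (2π) = ℝ/2πℤ` (Mathlib's `Real.Angle`).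

* `radialAdmissible = M(k)`, `angularAdmissible = M̆(k)`;
* `radialVolume A = μ_k(A)` := Lebesgue measure of `‖·‖ '' A ⊆ ℝ` (the length of the projection for the
  metric `dt` on `ℝ_{>0} ≅ {1} × ℝ_{>0}`), `angularVolume A = μ̆_k(A)` := Haar measure of total mass `2π`
  of the image of `A` in `ℝ/2πℤ` (arc length on `S¹`); `radialLogVolume`, `angularLogVolume`,
  `radialUnitVolume x = μ̇_k(x)`;
* PROVED: positivity and finiteness on `M(k)`, `M̆(k)`; additivity (a)(1); normalisations (a)(2)
  (`radialVolume_closedBall_one`, `angularVolume_sphere_one`); all of (b) (`radialLogVolume_smul`,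
  `angularVolume_smul`, `radialLogVolume_smul_of_norm_eq_one`, `radialUnitVolume_eq_norm`);
* NAMED FACT: (c) `ExpLogVolumeCompatible` (an exercise on Lebesgue measure under `t ↦ |t|` and
  `ℝ → ℝ/2πℤ` restricted to sets on which they are injective; left to a prover seat).

NOT here: part (i) (nonarchimedean) — `LocalVolumesNonarchimedean.lean`; Prop. 5.8 (iv)–(vi)
(reconstruction of these volumes from the topological monoid `𝒪_ℂ^▷`). Classical content; no disputed
claim is involved.
-/

set_option autoImplicit false

noncomputable section

open MeasureTheory MeasureTheory.Measure Set Metric Complex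
open scoped Pointwise NNReal ENNReal Real

namespace Literature.AnabelianGeometry.AbsoluteAnabelian

namespace ComplexVolume

/-- `2π > 0`, needed for the Haar measure of total mass `2π` on `ℝ/2πℤ` (Mathlib only provides this
`Fact` locally); instance plumbing. [folklore] -/
local instance instFactTwoPiPos : Fact (0 < 2 * Real.pi) := ⟨Real.two_pi_pos⟩

/-- the projection `k^× → 𝒪_k^× ≅ S¹ = ℝ/2πℤ`, `x ↦ arg x mod 2π` (extended by the junk value `0 ↦ 0`).
[cite: MochizukiAbsTopIII2015, Prop 5.7 (ii) p. 138] -/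
def phase (x : ℂ) : AddCircle (2 * Real.pi) := ((arg x : ℝ) : AddCircle (2 * Real.pi))

/-- `phase (x·y) = phase x + phase y` on `k^×` (the projection `k^× → 𝒪_k^×` is a homomorphism).
[cite: MochizukiAbsTopIII2015, Prop 5.7 (ii) p. 138] -/
theorem phase_mul {x y : ℂ} (hx : x ≠ 0) (hy : y ≠ 0) : phase (x * y) = phase x + phase y :=
  arg_mul_coe_angle hx hy

/-- `M(k)`: nonempty compact `A ⊆ k` whose projection `pr_ℝ(A) = ‖·‖ '' A ⊆ ℝ` is the closure of its
interior. [cite: MochizukiAbsTopIII2015, Prop 5.7 (ii) p. 138] -/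
def radialAdmissible : Set (Set ℂ) :=
  {A | A.Nonempty ∧ IsCompact A ∧ closure (interior ((‖·‖) '' A)) = (‖·‖) '' A}

/-- `M̆(k)`: nonempty compact `A ⊆ k^×` whose projection to `𝒪_k^× = ℝ/2πℤ` is the closure of its
interior. [cite: MochizukiAbsTopIII2015, Prop 5.7 (ii) p. 138] -/
def angularAdmissible : Set (Set ℂ) :=
  {A | A.Nonempty ∧ IsCompact A ∧ A ⊆ {0}ᶜ ∧ closure (interior (phase '' A)) = phase '' A}

/-- the *radial volume* `μ_k(A)`: the length of the projection `pr_ℝ(A) ⊆ ℝ` for the metric induced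
by the standard absolute value (Lebesgue measure of `‖·‖ '' A`), as a real number.
[cite: MochizukiAbsTopIII2015, Prop 5.7 (ii)(a) p. 138] -/
def radialVolume (A : Set ℂ) : ℝ := (volume ((‖·‖) '' A : Set ℝ)).toReal

/-- the *angular volume* `μ̆_k(A)`: the arc length of the projection of `A` to `𝒪_k^× = S¹`
(Haar measure of total mass `2π` on `ℝ/2πℤ` of `phase '' A`).
[cite: MochizukiAbsTopIII2015, Prop 5.7 (ii)(a) p. 138] -/
def angularVolume (A : Set ℂ) : ℝ := (volume (phase '' A)).toReal

/-- the *radial log-volume* `μ_k^log := log ∘ μ_k`. [cite: MochizukiAbsTopIII2015, Prop 5.7 (ii)(a) p. 138] -/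
def radialLogVolume (A : Set ℂ) : ℝ := Real.log (radialVolume A)

/-- the *angular log-volume* `μ̆_k^log := log ∘ μ̆_k`. [cite: MochizukiAbsTopIII2015, Prop 5.7 (ii)(a) p. 138] -/
def angularLogVolume (A : Set ℂ) : ℝ := Real.log (angularVolume A)

/-- `μ̇_k(x) := μ_k(x · 𝒪_k)` for `x ∈ k^×`, `𝒪_k = closedBall 0 1`.
[cite: MochizukiAbsTopIII2015, Prop 5.7 (ii)(b) p. 138] -/
def radialUnitVolume (x : ℂ) : ℝ := radialVolume (x • closedBall (0 : ℂ) 1)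

/-- `μ̇_k^log(x) := log μ̇_k(x)`. [cite: MochizukiAbsTopIII2015, Prop 5.7 (ii)(b) p. 138] -/
def radialUnitLogVolume (x : ℂ) : ℝ := Real.log (radialUnitVolume x)

/-! ## (a): positivity, finiteness, additivity, normalisation -/

/-- the projection `pr_ℝ(A)` of `A ∈ M(k)` is closed, hence Lebesgue measurable.
[cite: MochizukiAbsTopIII2015, Prop 5.7 (ii)(a) p. 138] -/
theorem measurableSet_norm_image {A : Set ℂ} (hA : A ∈ radialAdmissible) :
    MeasurableSet ((‖·‖) '' A : Set ℝ) := by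
  rw [← hA.2.2]; exact isClosed_closure.measurableSet

/-- the projection of `A ∈ M̆(k)` to `S¹` is closed, hence measurable.
[cite: MochizukiAbsTopIII2015, Prop 5.7 (ii)(a) p. 138] -/
theorem measurableSet_phase_image {A : Set ℂ} (hA : A ∈ angularAdmissible) :
    MeasurableSet (phase '' A) := by
  rw [← hA.2.2.2]; exact isClosed_closure.measurableSet

/-- `μ_k(A) < ∞` for compact `A` (the projection of a compact set is compact).
[cite: MochizukiAbsTopIII2015, Prop 5.7 (ii)(a) p. 138] -/
theorem volume_norm_image_lt_top {A : Set ℂ} (hA : IsCompact A) :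
    volume ((‖·‖) '' A : Set ℝ) < ∞ :=
  (hA.image continuous_norm).measure_lt_top

/-- `0 < μ_k(A)` for `A ∈ M(k)` (a nonempty closure of an open set of `ℝ` has positive length).
[cite: MochizukiAbsTopIII2015, Prop 5.7 (ii)(a) p. 138] -/
theorem radialVolume_pos {A : Set ℂ} (hA : A ∈ radialAdmissible) : 0 < radialVolume A := by
  obtain ⟨hne, hcpt, hcl⟩ := hA
  have hint : (interior ((‖·‖) '' A : Set ℝ)).Nonempty := by
    by_contra h
    rw [not_nonempty_iff_eq_empty] at h
    rw [h, closure_empty] at hcl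
    exact (hne.image _).ne_empty hcl.symm
  have hpos : 0 < volume (interior ((‖·‖) '' A : Set ℝ)) := isOpen_interior.measure_pos _ hint
  exact ENNReal.toReal_pos (ne_of_gt (lt_of_lt_of_le hpos (measure_mono interior_subset)))
    (volume_norm_image_lt_top hcpt).ne

/-- `0 < μ̆_k(A)` for `A ∈ M̆(k)`. [cite: MochizukiAbsTopIII2015, Prop 5.7 (ii)(a) p. 138] -/
theorem angularVolume_pos {A : Set ℂ} (hA : A ∈ angularAdmissible) : 0 < angularVolume A := by
  obtain ⟨hne, -, -, hcl⟩ := hA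
  have hint : (interior (phase '' A)).Nonempty := by
    by_contra h
    rw [not_nonempty_iff_eq_empty] at h
    rw [h, closure_empty] at hcl
    exact (hne.image _).ne_empty hcl.symm
  have hpos : 0 < volume (interior (phase '' A)) := isOpen_interior.measure_pos _ hint
  exact ENNReal.toReal_pos (ne_of_gt (lt_of_lt_of_le hpos (measure_mono interior_subset)))
    (measure_lt_top _ _).ne

/-- additivity (a)(1), radial: `μ_k(A ∪ B) = μ_k(A) + μ_k(B)` when the projections to `ℝ` are
disjoint. [cite: MochizukiAbsTopIII2015, Prop 5.7 (ii)(a)(1) p. 138] -/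
theorem radialVolume_union {A B : Set ℂ} (hA : A ∈ radialAdmissible) (hB : B ∈ radialAdmissible)
    (hAB : Disjoint ((‖·‖) '' A : Set ℝ) ((‖·‖) '' B)) :
    radialVolume (A ∪ B) = radialVolume A + radialVolume B := by
  rw [radialVolume, image_union, measure_union hAB (measurableSet_norm_image hB),
    ENNReal.toReal_add (volume_norm_image_lt_top hA.2.1).ne (volume_norm_image_lt_top hB.2.1).ne]
  rfl

/-- additivity (a)(1), angular: `μ̆_k(A ∪ B) = μ̆_k(A) + μ̆_k(B)` when the projections to `𝒪_k^×` are
disjoint. [cite: MochizukiAbsTopIII2015, Prop 5.7 (ii)(a)(1) p. 138] -/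
theorem angularVolume_union {A B : Set ℂ} (hB : B ∈ angularAdmissible)
    (hAB : Disjoint (phase '' A) (phase '' B)) :
    angularVolume (A ∪ B) = angularVolume A + angularVolume B := by
  rw [angularVolume, image_union, measure_union hAB (measurableSet_phase_image hB),
    ENNReal.toReal_add (measure_lt_top _ _).ne (measure_lt_top _ _).ne]
  rfl

/-- `pr_ℝ(𝒪_k) = [0, 1]`. [cite: MochizukiAbsTopIII2015, Prop 5.7 (ii)(a)(2) p. 138] -/
theorem norm_image_closedBall_one : ((‖·‖) '' closedBall (0 : ℂ) 1 : Set ℝ) = Icc 0 1 := by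
  ext r
  simp only [mem_image, mem_closedBall, dist_zero_right, mem_Icc]
  constructor
  · rintro ⟨a, ha, rfl⟩; exact ⟨norm_nonneg a, ha⟩
  · rintro ⟨h0, h1⟩
    refine ⟨(r : ℂ), ?_, ?_⟩ <;> simp [abs_of_nonneg h0, h1]

/-- normalisation (a)(2), radial: `μ_k(𝒪_k) = 1`. [cite: MochizukiAbsTopIII2015, Prop 5.7 (ii)(a)(2) p. 138] -/
theorem radialVolume_closedBall_one : radialVolume (closedBall (0 : ℂ) 1) = 1 := by
  rw [radialVolume, norm_image_closedBall_one, Real.volume_Icc]; simp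

/-- the projection of `𝒪_k^× = {‖x‖ = 1}` to `S¹ = ℝ/2πℤ` is everything.
[cite: MochizukiAbsTopIII2015, Prop 5.7 (ii)(a)(2) p. 138] -/
theorem phase_image_sphere_one : phase '' sphere (0 : ℂ) 1 = univ := by
  refine eq_univ_of_forall fun θ => ?_
  induction θ using QuotientAddGroup.induction_on with
  | H t =>
    refine ⟨Real.cos t + Real.sin t * I, by simp [Complex.norm_cos_add_sin_mul_I], ?_⟩
    exact arg_cos_add_sin_mul_I_coe_angle t

/-- normalisation (a)(2), angular: `μ̆_k(𝒪_k^×) = 2π`. [cite: MochizukiAbsTopIII2015, Prop 5.7 (ii)(a)(2) p. 138] -/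
theorem angularVolume_sphere_one : angularVolume (sphere (0 : ℂ) 1) = 2 * Real.pi := by
  rw [angularVolume, phase_image_sphere_one, AddCircle.measure_univ,
    ENNReal.toReal_ofReal Real.two_pi_pos.le]

/-! ## (b): behaviour under multiplication by `x ∈ k^×` -/

/-- `pr_ℝ(x · A) = ‖x‖ · pr_ℝ(A)`. [cite: MochizukiAbsTopIII2015, Prop 5.7 (ii)(b) p. 138] -/
theorem norm_image_smul (x : ℂ) (A : Set ℂ) :
    ((‖·‖) '' (x • A) : Set ℝ) = ‖x‖ • ((‖·‖) '' A) := by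
  ext r
  simp only [mem_image, mem_smul_set, smul_eq_mul]
  constructor
  · rintro ⟨_, ⟨a, ha, rfl⟩, rfl⟩; exact ⟨‖a‖, ⟨a, ha, rfl⟩, (norm_mul x a).symm⟩
  · rintro ⟨_, ⟨a, ha, rfl⟩, rfl⟩; exact ⟨x * a, ⟨a, ha, rfl⟩, norm_mul x a⟩

/-- `μ_k(x · A) = ‖x‖ · μ_k(A)` for every `A`. [cite: MochizukiAbsTopIII2015, Prop 5.7 (ii)(b) p. 138] -/
theorem radialVolume_smul (x : ℂ) (A : Set ℂ) : radialVolume (x • A) = ‖x‖ * radialVolume A := by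
  rw [radialVolume, radialVolume, norm_image_smul, addHaar_smul, Module.finrank_self, pow_one,
    abs_of_nonneg (norm_nonneg x), ENNReal.toReal_mul, ENNReal.toReal_ofReal (norm_nonneg x)]

/-- `μ̇_k(x) = ‖x‖`. [cite: MochizukiAbsTopIII2015, Prop 5.7 (ii)(b) p. 138] -/
theorem radialUnitVolume_eq_norm (x : ℂ) : radialUnitVolume x = ‖x‖ := by
  rw [radialUnitVolume, radialVolume_smul, radialVolume_closedBall_one, mul_one]

/-- **Prop 5.7 (ii)(b), radial**: `μ_k^log(x · A) = μ_k^log(A) + μ̇_k^log(x)` for `A ∈ M(k)`, `x ∈ k^×`.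
[cite: MochizukiAbsTopIII2015, Prop 5.7 (ii)(b) p. 138] -/
theorem radialLogVolume_smul {x : ℂ} (hx : x ≠ 0) {A : Set ℂ} (hA : A ∈ radialAdmissible) :
    radialLogVolume (x • A) = radialLogVolume A + radialUnitLogVolume x := by
  rw [radialLogVolume, radialLogVolume, radialUnitLogVolume, radialVolume_smul,
    radialUnitVolume_eq_norm, mul_comm, Real.log_mul (radialVolume_pos hA).ne' (norm_ne_zero_iff.2 hx)]

/-- **Prop 5.7 (ii)(b), in particular**: `μ_k^log(x · A) = μ_k^log(A)` for `x ∈ 𝒪_k^×` (`‖x‖ = 1`), for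
every `A`. [cite: MochizukiAbsTopIII2015, Prop 5.7 (ii)(b) p. 138] -/
theorem radialLogVolume_smul_of_norm_eq_one {x : ℂ} (hx : ‖x‖ = 1) (A : Set ℂ) :
    radialLogVolume (x • A) = radialLogVolume A := by
  rw [radialLogVolume, radialLogVolume, radialVolume_smul, hx, one_mul]

/-- the projection to `S¹` of `x · A` is the rotate of the projection of `A` by `phase x`
(`A ⊆ k^×`, `x ∈ k^×`). [cite: MochizukiAbsTopIII2015, Prop 5.7 (ii)(b) p. 138] -/
theorem phase_image_smul {x : ℂ} (hx : x ≠ 0) {A : Set ℂ} (hA : A ⊆ {0}ᶜ) :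
    phase '' (x • A) = phase x +ᵥ phase '' A := by
  ext θ
  simp only [mem_image, mem_smul_set, mem_vadd_set, smul_eq_mul, vadd_eq_add]
  constructor
  · rintro ⟨_, ⟨a, ha, rfl⟩, rfl⟩
    exact ⟨phase a, ⟨a, ha, rfl⟩, (phase_mul hx (hA ha)).symm⟩
  · rintro ⟨_, ⟨a, ha, rfl⟩, rfl⟩
    exact ⟨x * a, ⟨a, ha, rfl⟩, phase_mul hx (hA ha)⟩

/-- **Prop 5.7 (ii)(b), angular**: `μ̆_k(x · A) = μ̆_k(A)` (hence `μ̆_k^log(x · A) = μ̆_k^log(A)`) for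
`A ⊆ k^×`, `x ∈ k^×` — rotation invariance of arc length. [cite: MochizukiAbsTopIII2015, Prop 5.7 (ii)(b) p. 138] -/
theorem angularVolume_smul {x : ℂ} (hx : x ≠ 0) {A : Set ℂ} (hA : A ⊆ {0}ᶜ) :
    angularVolume (x • A) = angularVolume A := by
  rw [angularVolume, angularVolume, phase_image_smul hx hA, measure_vadd]

/-- **Prop 5.7 (ii)(b), angular log-volume**: `μ̆_k^log(x · A) = μ̆_k^log(A)`.
[cite: MochizukiAbsTopIII2015, Prop 5.7 (ii)(b) p. 138] -/
theorem angularLogVolume_smul {x : ℂ} (hx : x ≠ 0) {A : Set ℂ} (hA : A ⊆ {0}ᶜ) :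
    angularLogVolume (x • A) = angularLogVolume A := by
  rw [angularLogVolume, angularLogVolume, angularVolume_smul hx hA]

/-! ## (c): compatibility with the exponential (named fact) -/

/-- **Prop 5.7 (ii)(c)** (named fact, not proved here): let `A ∈ M(k)` with `exp_k(A) ⊆ 𝒪_k^×` and
such that `pr_ℝ` and `exp_k` are injective on `A`; then `μ_k^log(A) = μ̆_k^log(exp_k(A))` — the length of
`{|t| : it ∈ A}` equals the arc length of `{e^{it}}` when `t ↦ |t|` and `t ↦ t mod 2π` are injective on
`{t : it ∈ A}`. [cite: MochizukiAbsTopIII2015, Prop 5.7 (ii)(c) p. 138] -/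
def ExpLogVolumeCompatible : Prop :=
  ∀ A ∈ radialAdmissible, exp '' A ⊆ sphere (0 : ℂ) 1 → InjOn (‖·‖) A → InjOn exp A →
    radialLogVolume A = angularLogVolume (exp '' A)

end ComplexVolume

end Literature.AnabelianGeometry.AbsoluteAnabelian

end
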